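import Summits.HodgeConjecture.HodgeConjecture.Theorems.Ring2HypothesesDescentMotivatedTraceFormulaPairing
import Summits.HodgeConjecture.HodgeConjecture.Theorems.Ring2HypothesesDescentMotivatedKunneth
import Summits.HodgeConjecture.HodgeConjecture.Theorems.Ring2HypothesesDescentMotivatedNumerical
import Summits.HodgeConjecture.HodgeConjecture.Theorems.Ring2HypothesesDescentMotivatedPullback
import Mathlib.RingTheory.Artinian.Module
import HarnessLib

/-!
# Ring 2 hypotheses, descent face — André's Prop. 3.1 and the semisimplicity clause of Prop. 3.3 on the real carriers:
# nil ideals of motivated endo-correspondences are numerically trivial, hence ZERO; the algebra of operators on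
# `Hᵃ(X(ℂ); ℂ)` induced by `A_motⁿ(X ⊗ X)_ℂ` is SEMISIMPLE, and `Hᵃ(X(ℂ); ℂ)` is completely reducible under it

research route conditional on HC_CM; not a corollary; Q11.4-sentence-2 already refuted in dim ≥ 3.
Cell `pub-hodge-ring2` (Hodge ladder STAGE 3), seat `ring2-b05` (binder row b05
`Ring2.Hypotheses.MotivatedImpliesAlgebraicAV`), gen 37. `HC_CM` (`Theses.RankFourFaces.CMAbelianHodge`) does
not occur in this file; nothing here proves a case of the Hodge conjecture; the row b05 stays OPEN.

André 1996, Prop. 3.1 (p. 20): «L'idéal `𝒩` formé des cycles motivés `≡ 0` est le plus grand nilidéal (à gauche ou à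
droite) homogène de `C_mot(X, X)`. Il est nilpotent. (C'est l'analogue pour les cycles motivés du théorème de Jannsen
[J92].) Preuve. — Soit `𝒥` un nilidéal … et soit `f` un élément de `𝒥` … Pour tout `g`, `f ∘ g` est donc nilpotent …
Dès lors, `Tr_{Hⁱ}(f ∘ g) = 0` pour tout `i`, et la formule de trace donne `⟨f ∪ ᵗg⟩ = Σᵢ (-1)ⁱ Tr_{Hⁱ}(f ∘ g) = 0`.
Ceci montre que l'image de `𝒥` dans `C_mot(X, X)/𝒩` est nulle»; Corollaire of 3.2.1 (p. 21): «l'algèbre quotient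
`C⁰_mot(X, X)_E / 𝒩` est semi-simple de dimension finie»; Prop. 3.3 (p. 21): «Supposons que `K` soit de caractéristique
nulle et que `H` soit une cohomologie classique … Alors `≡` est l'égalité sur `A_mot(X)`. La `ℚ`-algèbre `C⁰_mot(X, X)`
est semi-simple de dimension finie.» The tree has `≡` = equality (hom ≡ num on `A_mot(X ⊗ X)_ℂ`,
`eq_zero_of_forall_cupProduct_motivated_eq_zero`, gen 36) and now the trace formula (`…TraceFormulaPairing`, gen 37);
this file draws Prop. 3.1 and the semisimplicity clause on the real carriers, for the DEGREE-`a` COMPONENTS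
`R_a = image of A_motⁿ(X ⊗ X)_ℂ in End_ℂ Hᵃ(X(ℂ); ℂ)` of `C⁰_mot(X, X)_ℂ` (which is `Πₐ R_a` through the motivated Künneth
projectors of `…MotivatedKunneth`), with `ℂ`-coefficients throughout (F-ref2-83):

* §1 **`eq_zero_of_forall_trace_comp_motivated_eq_zero`** — a motivated `u ∈ A_motⁿ(X ⊗ X)_ℂ` with
  `Tr([w]_* ∘ [u]_* | Hᵃ) = 0` for all motivated `w` and all `a` is ZERO (trace formula + `ᵗ(A_mot) = A_mot` + hom ≡ num);
  per degree (`corrAction_eq_zero_of_forall_trace_comp_motivated_eq_zero`, via the motivated Künneth projector `πᵃ`):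
  `Tr([w]_* ∘ [u]_* | Hᵃ) = 0` for all motivated `w` forces `[u]_* = 0` on `Hᵃ`.
* §2 **ANDRÉ PROP. 3.1 / 3.3 (radical form)**: `corrAction_eq_zero_of_forall_isNilpotent_comp` (left) and `…_comp'`
  (right) — if `[w]_* ∘ [u]_*` (resp. `[u]_* ∘ [w]_*`) is nilpotent on `Hᵃ` for every motivated `w`, then `[u]_* = 0`
  on `Hᵃ`: `R_a` has NO non-zero nil one-sided ideal; `eq_zero_of_forall_isNilpotent_comp` (all degrees ⟹ `u = 0`).
* §3 **`isSemisimpleRing_adjoin_motivatedOperators`** — the `ℂ`-algebra `R_a ⊆ End_ℂ Hᵃ(X(ℂ); ℂ)` (the subalgebra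
  generated by = equal to the image of `A_motⁿ(X ⊗ X)_ℂ`, `adjoin_motivatedOperators_eq`) is a SEMISIMPLE ring
  (finite-dimensional ⟹ Artinian ⟹ Jacobson radical nilpotent ⟹ zero by §2; Mathlib's
  `IsArtinianRing.isSemisimpleRing_iff_jacobson`); `isSemisimpleModule_motivatedOperators` — `Hᵃ(X(ℂ); ℂ)` is a
  semisimple `R_a`-module; **`exists_isCompl_of_motivatedOperators_stable`** — every `ℂ`-subspace of `Hᵃ(X(ℂ); ℂ)`
  stable under all motivated correspondence operators has a stable complement (complete reducibility).

No definition (the subalgebra is `Algebra.adjoin` of the image submodule), no named fact, no sorry. References: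
Andre1996Motifs (Prop. 3.1 p. 20, Cor. p. 21, Prop. 3.3 p. 21), Jannsen1992 (Motives, numerical equivalence, and
semi-simplicity, Invent. Math. 107, Lemma 1–2), Kleiman1968AlgebraicCycles (§1.3 Prop. 1.3.6, §3 Prop. 3.5–3.8).
-/

noncomputable section

-- every declaration of this problem lives in `Summit.HodgeConjecture.HodgeConjecture.…` (summit = sub-problem)
set_option linter.dupNamespace false

open CategoryTheory AlgebraicGeometry MonoidalCategory CartesianMonoidalCategory
open Literature.AlgebraicTopology.SingularHomology Literature.Geometry.Kaehler
open Literature.AlgebraicGeometry Literature.AlgebraicGeometry.Motives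
  Literature.AlgebraicGeometry.HodgeTheory

namespace Summit.HodgeConjecture.HodgeConjecture.Theorems

variable (μ : OrientationFamily) {n : ℕ} {X : SchemeOver ℂ}

/-! ## §1 Trace-orthogonal motivated correspondences vanish -/

/-- **A motivated endo-correspondence trace-orthogonal to all motivated ones is zero** (the heart of André's
Prop. 3.1 with Prop. 3.3's `𝒩 = 0`): for `X` smooth projective of dimension `n` and `u ∈ A_motⁿ(X ⊗ X)_ℂ`, if
`Tr([w]_* ∘ [u]_* | Hᵃ(X(ℂ))) = 0` for every motivated `w ∈ A_motⁿ(X ⊗ X)_ℂ` and every `a ≤ 2n`, then `u = 0`. By the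
trace formula `p₁₊ p₂^* p₁₊ (u ∪ σ^* w) = 0`; every motivated `v` is `σ^* (σ^* v)` with `σ^* v` motivated
(`map_mem_motivatedClasses`, Prop. 2.1 (ii)); so `u ∪ v = 0` for all `v ∈ A_motⁿ(X ⊗ X)_ℂ`
(`eq_zero_of_fibreIntegral_fst_eq_zero`) and `u = 0` because `≡` is equality on `A_mot(X ⊗ X)_ℂ`
(`eq_zero_of_forall_cupProduct_motivated_eq_zero`). [cite: Andre1996Motifs, Prop. 3.1 (p. 20) and Prop. 3.3 (p. 21)]
[cite: Kleiman1968AlgebraicCycles, §1.3 Prop. 1.3.6] -/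
theorem eq_zero_of_forall_trace_comp_motivated_eq_zero (hX : IsSmoothProjective n X)
    {u : complexBetti (X ⊗ X) (2 * n)} (hu : u ∈ motivatedClasses (n + n) (X ⊗ X) n)
    (h : ∀ w ∈ motivatedClasses (n + n) (X ⊗ X) n, ∀ a ≤ 2 * n,
      LinearMap.trace ℂ _ (corrAction μ hX hX (rfl : a + 2 * n = a + 2 * n) w ∘ₗ
        corrAction μ hX hX (rfl : a + 2 * n = a + 2 * n) u) = 0) :
    u = 0 := by
  have hXX := IsSmoothProjective.tensor_holds hX hX
  refine eq_zero_of_forall_cupProduct_motivated_eq_zero hXX (p := n) (q := n) rfl hu fun v hv ↦ ?_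
  have hσv : complexBetti.map (β_ X X).hom (2 * n) v ∈ motivatedClasses (n + n) (X ⊗ X) n :=
    map_mem_motivatedClasses (β_ X X).hom hXX hXX n hv
  have hvv : v = complexBetti.map (β_ X X).hom (2 * n) (complexBetti.map (β_ X X).hom (2 * n) v) := by
    rw [← complexBetti.map_comp_apply', SymmetricCategory.symmetry, complexBetti.map_id]
    rfl
  rw [hvv]
  refine eq_zero_of_fibreIntegral_fst_eq_zero μ hX ?_
  rw [← gradedTrace_corrAction_comp_smul_one μ hX u, Finset.sum_eq_zero, zero_smul]
  intro a ha
  rw [h _ hσv a (by simpa [Nat.lt_succ_iff] using Finset.mem_range.mp ha), mul_zero]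

/-- **Per degree: `Tr([w]_* ∘ [u]_* | Hᵃ) = 0` for all motivated `w` forces `[u]_* = 0` on `Hᵃ(X(ℂ); ℂ)`** (`u`
motivated, `a` fixed). Replace `u` by the motivated composite `u ∘ πᵃ` with the motivated Künneth projector `πᵃ`
(`exists_motivated_kunnethProjector`, `exists_corrCompClass_total`): it acts as `[u]_*` on `Hᵃ` and as `0` elsewhere, so
ALL its traces against motivated classes vanish and §1's `eq_zero_of_forall_trace_comp_motivated_eq_zero` applies.
[cite: Andre1996Motifs, Prop. 3.1 (p. 20) and Prop. 2.2 (p. 16)] [cite: Kleiman1968AlgebraicCycles, §1.4 Prop. 1.4.4] -/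
theorem corrAction_eq_zero_of_forall_trace_comp_motivated_eq_zero (hX : IsSmoothProjective n X)
    {u : complexBetti (X ⊗ X) (2 * n)} (hu : u ∈ motivatedClasses (n + n) (X ⊗ X) n) {a : ℕ}
    (h : ∀ w ∈ motivatedClasses (n + n) (X ⊗ X) n,
      LinearMap.trace ℂ _ (corrAction μ hX hX (rfl : a + 2 * n = a + 2 * n) w ∘ₗ
        corrAction μ hX hX (rfl : a + 2 * n = a + 2 * n) u) = 0) :
    corrAction μ hX hX (rfl : a + 2 * n = a + 2 * n) u = 0 := by
  obtain ⟨π, hπ, hπa⟩ := exists_motivated_kunnethProjector μ hX a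
  obtain ⟨u', hu'mot, -, hact⟩ := exists_corrCompClass_total μ hX hX hX (e := n) (e' := n) (e'' := n) rfl u π
  have hu' : u' ∈ motivatedClasses (n + n) (X ⊗ X) n := hu'mot hu hπ
  have hact' : ∀ a' : ℕ, corrAction μ hX hX (rfl : a' + 2 * n = a' + 2 * n) u' =
      corrAction μ hX hX (rfl : a' + 2 * n = a' + 2 * n) u ∘ₗ (if a' = a then LinearMap.id else 0) := fun a' ↦ by
    rw [hact (a := a') (a₁ := a') (a₂ := a') rfl rfl rfl, hπa a']
  have hu'0 : u' = 0 := by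
    refine eq_zero_of_forall_trace_comp_motivated_eq_zero μ hX hu' fun w hw a' _ ↦ ?_
    rw [hact' a']
    split_ifs with haa
    · subst haa
      rw [LinearMap.comp_id]
      exact h w hw
    · rw [LinearMap.comp_zero, LinearMap.comp_zero, map_zero]
  have hfin := hact' a
  rw [hu'0, map_zero, if_pos rfl, LinearMap.comp_id] at hfin
  exact hfin.symm

/-! ## §2 André's Prop. 3.1 / 3.3: nil one-sided ideals of motivated endo-correspondence operators are zero -/

/-- **ANDRÉ PROP. 3.1 + PROP. 3.3 (left nil ideals), on the real carriers.** For `X` smooth projective of dimension `n`,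
an orientation family `μ`, a degree `a` and a motivated `u ∈ A_motⁿ(X ⊗ X)_ℂ`: if `[w]_* ∘ [u]_*` is nilpotent on
`Hᵃ(X(ℂ); ℂ)` for every motivated `w`, then `[u]_* = 0` on `Hᵃ(X(ℂ); ℂ)` — the operator algebra `R_a` induced by
`A_motⁿ(X ⊗ X)_ℂ` on `Hᵃ` has no non-zero nil left ideal («`𝒩` est le plus grand nilidéal», and `𝒩 = 0` for Betti
cohomology). Nilpotent operators have trace `0` (`LinearMap.isNilpotent_trace_of_isNilpotent`); conclude by §1.
[cite: Andre1996Motifs, Prop. 3.1 (p. 20) and Prop. 3.3 (p. 21)] [cite: Jannsen1992, Lemma 1] -/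
theorem corrAction_eq_zero_of_forall_isNilpotent_comp (hX : IsSmoothProjective n X)
    {u : complexBetti (X ⊗ X) (2 * n)} (hu : u ∈ motivatedClasses (n + n) (X ⊗ X) n) {a : ℕ}
    (h : ∀ w ∈ motivatedClasses (n + n) (X ⊗ X) n,
      IsNilpotent (corrAction μ hX hX (rfl : a + 2 * n = a + 2 * n) w ∘ₗ
        corrAction μ hX hX (rfl : a + 2 * n = a + 2 * n) u)) :
    corrAction μ hX hX (rfl : a + 2 * n = a + 2 * n) u = 0 :=
  corrAction_eq_zero_of_forall_trace_comp_motivated_eq_zero μ hX hu fun w hw ↦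
    (LinearMap.isNilpotent_trace_of_isNilpotent (h w hw)).eq_zero

/-- **ANDRÉ PROP. 3.1 + PROP. 3.3 (right nil ideals), on the real carriers**: if `[u]_* ∘ [w]_*` is nilpotent on
`Hᵃ(X(ℂ); ℂ)` for every motivated `w`, then `[u]_* = 0` on `Hᵃ` (`Tr(AB) = Tr(BA)`).
[cite: Andre1996Motifs, Prop. 3.1 (p. 20) and Prop. 3.3 (p. 21)] [cite: Jannsen1992, Lemma 1] -/
theorem corrAction_eq_zero_of_forall_isNilpotent_comp' (hX : IsSmoothProjective n X)
    {u : complexBetti (X ⊗ X) (2 * n)} (hu : u ∈ motivatedClasses (n + n) (X ⊗ X) n) {a : ℕ}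
    (h : ∀ w ∈ motivatedClasses (n + n) (X ⊗ X) n,
      IsNilpotent (corrAction μ hX hX (rfl : a + 2 * n = a + 2 * n) u ∘ₗ
        corrAction μ hX hX (rfl : a + 2 * n = a + 2 * n) w)) :
    corrAction μ hX hX (rfl : a + 2 * n = a + 2 * n) u = 0 := by
  haveI : Module.Finite ℂ (complexBetti X a) := finite_complexBetti hX a
  refine corrAction_eq_zero_of_forall_trace_comp_motivated_eq_zero μ hX hu fun w hw ↦ ?_
  rw [← Module.End.mul_eq_comp, LinearMap.trace_mul_comm, Module.End.mul_eq_comp]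
  exact (LinearMap.isNilpotent_trace_of_isNilpotent (h w hw)).eq_zero

/-- **All degrees: a motivated `u` with `[w]_* ∘ [u]_*` nilpotent on every `Hᵃ` for every motivated `w` is ZERO** (§2 per
degree and faithfulness of the total action, `eq_zero_of_forall_corrAction_eq_zero`).
[cite: Andre1996Motifs, Prop. 3.1 (p. 20) and Prop. 3.3 (p. 21)] -/
theorem eq_zero_of_forall_isNilpotent_comp (hX : IsSmoothProjective n X)
    {u : complexBetti (X ⊗ X) (2 * n)} (hu : u ∈ motivatedClasses (n + n) (X ⊗ X) n)
    (h : ∀ w ∈ motivatedClasses (n + n) (X ⊗ X) n, ∀ a ≤ 2 * n,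
      IsNilpotent (corrAction μ hX hX (rfl : a + 2 * n = a + 2 * n) w ∘ₗ
        corrAction μ hX hX (rfl : a + 2 * n = a + 2 * n) u)) :
    u = 0 :=
  eq_zero_of_forall_corrAction_eq_zero μ hX fun _ ha ↦
    corrAction_eq_zero_of_forall_isNilpotent_comp μ hX hu fun w hw ↦ h w hw _ ha

/-! ## §3 The operator algebra `R_a ⊆ End_ℂ Hᵃ(X(ℂ); ℂ)` of `A_motⁿ(X ⊗ X)_ℂ` is semisimple -/

/-- **The image of `A_motⁿ(X ⊗ X)_ℂ` in `End_ℂ Hᵃ(X(ℂ); ℂ)` is a unital subalgebra**: the subalgebra it generates is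
(as a set) the image itself — it contains `1 = [Δ]_*` (`corrAction_diagonalClass`, `[Δ]` algebraic hence motivated for
the polarisation `η ⊞ η`) and is closed under composition (`comp_mem_map_corrAction_motivatedClasses`, André §2.1
Corollaire). [cite: Andre1996Motifs, §2.1 Corollaire (p. 15)] -/
theorem adjoin_motivatedOperators_eq (hX : IsSmoothProjective n X) (a : ℕ) :
    (Algebra.adjoin ℂ ((motivatedClasses (n + n) (X ⊗ X) n).map
        (corrAction μ hX hX (rfl : a + 2 * n = a + 2 * n)) : Set (Module.End ℂ (complexBetti X a))) :
        Set (Module.End ℂ (complexBetti X a))) =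
      (motivatedClasses (n + n) (X ⊗ X) n).map (corrAction μ hX hX (rfl : a + 2 * n = a + 2 * n)) := by
  set M := (motivatedClasses (n + n) (X ⊗ X) n).map (corrAction μ hX hX (rfl : a + 2 * n = a + 2 * n)) with hM
  have hXX : IsSmoothProjective (n + n) (X ⊗ X) := IsSmoothProjective.tensor_holds hX hX
  -- `1 ∈ M`
  have hone : (1 : Module.End ℂ (complexBetti X a)) ∈ M := by
    obtain ⟨Λ₀⟩ := nonempty_hardLefschetzNFold_holds n X hX
    have hη : IsPolarizationClass n X Λ₀.hyperplaneClass := Λ₀.isPolarizationClass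
    refine ⟨_, algebraicClasses_le_motivatedClasses_of_isPolarizationClass hXX (isPolarizationClass_boxSum hX hX hη hη)
      n (corrAction_diagonalClass μ hX 0).1, ?_⟩
    rw [(corrAction_diagonalClass μ hX a).2, Module.End.one_eq_id]
  -- closed under `*`
  have hmul : ∀ S ∈ M, ∀ T ∈ M, S * T ∈ M := fun S hS T hT ↦ by
    rw [Module.End.mul_eq_comp]
    exact comp_mem_map_corrAction_motivatedClasses μ hX hX hX (show n + n = n + n from rfl) rfl rfl rfl hS hT
  let B : Subalgebra ℂ (Module.End ℂ (complexBetti X a)) :=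
    { carrier := M
      mul_mem' := fun hS hT ↦ hmul _ hS _ hT
      one_mem' := hone
      add_mem' := fun hS hT ↦ M.add_mem hS hT
      zero_mem' := M.zero_mem
      algebraMap_mem' := fun c ↦ by
        rw [Algebra.algebraMap_eq_smul_one]
        exact M.smul_mem c hone }
  have hadj : Algebra.adjoin ℂ (M : Set (Module.End ℂ (complexBetti X a))) = B :=
    le_antisymm (Algebra.adjoin_le fun x hx ↦ hx) fun x hx ↦ Algebra.subset_adjoin hx
  rw [hadj]
  rfl

/-- **ANDRÉ PROP. 3.3, SEMISIMPLICITY CLAUSE, on the real carriers: the `ℂ`-algebra `R_a` of operators on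
`Hᵃ(X(ℂ); ℂ)` induced by the motivated classes `A_motⁿ(X ⊗ X)_ℂ` is SEMISIMPLE** («La `ℚ`-algèbre `C⁰_mot(X, X)` est
semi-simple de dimension finie»; here its degree-`a` component with `ℂ`-coefficients, `R_a` = the subalgebra of
`End_ℂ Hᵃ` generated by — equal to — the image of `A_motⁿ(X ⊗ X)_ℂ`). `R_a` is finite-dimensional, hence Artinian,
so its Jacobson radical `J` is nilpotent (`IsSemiprimaryRing`); every `x ∈ J` then generates a nil left ideal
(`y x ∈ J` for all `y ∈ R_a`), so `x = 0` by Prop. 3.1 (`corrAction_eq_zero_of_forall_isNilpotent_comp`); `J = 0` and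
`R_a` is semisimple (`IsArtinianRing.isSemisimpleRing_iff_jacobson`). [cite: Andre1996Motifs, Prop. 3.3 (p. 21) and Corollaire (p. 21)]
[cite: Jannsen1992, Lemma 1–2] -/
theorem isSemisimpleRing_adjoin_motivatedOperators (hX : IsSmoothProjective n X) (a : ℕ) :
    IsSemisimpleRing (Algebra.adjoin ℂ ((motivatedClasses (n + n) (X ⊗ X) n).map
      (corrAction μ hX hX (rfl : a + 2 * n = a + 2 * n)) : Set (Module.End ℂ (complexBetti X a)))) := by
  set M := (motivatedClasses (n + n) (X ⊗ X) n).map (corrAction μ hX hX (rfl : a + 2 * n = a + 2 * n)) with hM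
  set B := Algebra.adjoin ℂ (M : Set (Module.End ℂ (complexBetti X a))) with hB
  have hBM : ∀ x : Module.End ℂ (complexBetti X a), x ∈ B ↔ x ∈ M := fun x ↦ by
    rw [← SetLike.mem_coe, hB, hM, adjoin_motivatedOperators_eq μ hX a, SetLike.mem_coe]
  haveI : Module.Finite ℂ (complexBetti X a) := finite_complexBetti hX a
  haveI : IsArtinianRing B := IsArtinianRing.of_finite ℂ B
  rw [IsArtinianRing.isSemisimpleRing_iff_jacobson]
  refine eq_bot_iff.mpr fun x hx ↦ ?_
  obtain ⟨k, hk⟩ := IsSemiprimaryRing.isNilpotent (R := B)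
  -- every `y * x`, `y ∈ B`, is nilpotent
  have hnil : ∀ y : B, IsNilpotent ((y : Module.End ℂ (complexBetti X a)) * x) := fun y ↦ by
    have hyx := Ideal.pow_mem_pow (Ideal.mul_mem_left _ y hx) k
    rw [hk, Ideal.zero_eq_bot, Ideal.mem_bot] at hyx
    exact ⟨k, by rw [← Subalgebra.coe_mul, ← Subalgebra.coe_pow, hyx, Subalgebra.coe_zero]⟩
  -- so `x = 0` by Prop. 3.1
  obtain ⟨u, hu, hux⟩ := (hBM x).mp x.2
  have hx0 : (x : Module.End ℂ (complexBetti X a)) = 0 := by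
    rw [← hux]
    refine corrAction_eq_zero_of_forall_isNilpotent_comp μ hX hu fun w hw ↦ ?_
    rw [hux, ← Module.End.mul_eq_comp]
    exact hnil ⟨_, (hBM _).mpr ⟨w, hw, rfl⟩⟩
  rw [Ideal.mem_bot]
  exact Subtype.ext hx0

/-- **`Hᵃ(X(ℂ); ℂ)` is a semisimple module over the motivated operator algebra `R_a`** (every module over a
semisimple ring is semisimple). [cite: Andre1996Motifs, Prop. 3.3 (p. 21)] [cite: Jannsen1992, Lemma 2] -/
theorem isSemisimpleModule_motivatedOperators (hX : IsSmoothProjective n X) (a : ℕ) :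
    IsSemisimpleModule (Algebra.adjoin ℂ ((motivatedClasses (n + n) (X ⊗ X) n).map
      (corrAction μ hX hX (rfl : a + 2 * n = a + 2 * n)) : Set (Module.End ℂ (complexBetti X a))))
      (complexBetti X a) := by
  haveI := isSemisimpleRing_adjoin_motivatedOperators μ hX a
  infer_instance

/-- **COMPLETE REDUCIBILITY of `Hᵃ(X(ℂ); ℂ)` under motivated correspondences.** For `X` smooth projective of
dimension `n`, an orientation family `μ` and a degree `a`: every `ℂ`-subspace `W ⊆ Hᵃ(X(ℂ); ℂ)` stable under `[u]_*`
for all motivated `u ∈ A_motⁿ(X ⊗ X)_ℂ` has a complement `W'` (`W ⊕ W' = Hᵃ`) stable under all of them (the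
`R_a`-submodule `W` of the semisimple `R_a`-module `Hᵃ` has an `R_a`-stable complement).
[cite: Andre1996Motifs, Prop. 3.3 (p. 21)] [cite: Jannsen1992, Lemma 2] -/
theorem exists_isCompl_of_motivatedOperators_stable (hX : IsSmoothProjective n X) (a : ℕ)
    {W : Submodule ℂ (complexBetti X a)}
    (hW : ∀ u ∈ motivatedClasses (n + n) (X ⊗ X) n, ∀ v ∈ W,
      corrAction μ hX hX (rfl : a + 2 * n = a + 2 * n) u v ∈ W) :
    ∃ W' : Submodule ℂ (complexBetti X a), IsCompl W W' ∧
      ∀ u ∈ motivatedClasses (n + n) (X ⊗ X) n, ∀ v ∈ W',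
        corrAction μ hX hX (rfl : a + 2 * n = a + 2 * n) u v ∈ W' := by
  set M := (motivatedClasses (n + n) (X ⊗ X) n).map (corrAction μ hX hX (rfl : a + 2 * n = a + 2 * n)) with hM
  set B := Algebra.adjoin ℂ (M : Set (Module.End ℂ (complexBetti X a))) with hB
  have hBM : ∀ x : Module.End ℂ (complexBetti X a), x ∈ B ↔ x ∈ M := fun x ↦ by
    rw [← SetLike.mem_coe, hB, hM, adjoin_motivatedOperators_eq μ hX a, SetLike.mem_coe]
  haveI := isSemisimpleModule_motivatedOperators μ hX a
  -- `W` as a `B`-submodule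
  have hWB : ∀ (T : B) (v : complexBetti X a), v ∈ W → (T : Module.End ℂ (complexBetti X a)) v ∈ W := by
    rintro ⟨T, hT⟩ v hv
    obtain ⟨u, hu, rfl⟩ := (hBM T).mp hT
    exact hW u hu v hv
  let WB : Submodule B (complexBetti X a) :=
    { carrier := W
      add_mem' := fun hv hw ↦ W.add_mem hv hw
      zero_mem' := W.zero_mem
      smul_mem' := fun T v hv ↦ hWB T v hv }
  obtain ⟨WB', hcompl⟩ := exists_isCompl WB
  -- back to a `ℂ`-subspace
  let W' : Submodule ℂ (complexBetti X a) :=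
    { carrier := WB'
      add_mem' := fun hv hw ↦ WB'.add_mem hv hw
      zero_mem' := WB'.zero_mem
      smul_mem' := fun c v hv ↦ by
        have h := WB'.smul_mem (algebraMap ℂ B c) hv
        have e : (algebraMap ℂ B c) • v = c • v := by
          change ((algebraMap ℂ B c : B) : Module.End ℂ (complexBetti X a)) v = c • v
          rw [Subalgebra.coe_algebraMap, Module.algebraMap_end_apply]
        rwa [e] at h }
  refine ⟨W', ⟨?_, ?_⟩, fun u hu v hv ↦ ?_⟩
  · rw [Submodule.disjoint_def]
    intro v hv hv'
    have h := (Submodule.disjoint_def.mp hcompl.disjoint) v hv hv'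
    exact h
  · rw [codisjoint_iff_le_sup]
    intro v _
    have h : v ∈ WB ⊔ WB' := hcompl.codisjoint.top_le (Submodule.mem_top : v ∈ (⊤ : Submodule B _))
    obtain ⟨y, hy, z, hz, rfl⟩ := Submodule.mem_sup.mp h
    exact Submodule.mem_sup.mpr ⟨y, hy, z, hz, rfl⟩
  · have hT : corrAction μ hX hX (rfl : a + 2 * n = a + 2 * n) u ∈ B := (hBM _).mpr ⟨u, hu, rfl⟩
    exact WB'.smul_mem (⟨_, hT⟩ : B) hv

end Summit.HodgeConjecture.HodgeConjecture.Theorems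

end
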